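import Literature.Geometry.GaugeTheory.AdaptedFramesCanonicalConnection
import HarnessLib

/-!
# Taubes's torsion `b` as the covariant derivative of `J`, and the Dirac equation for `u₀` as the
# quasi-Kähler identity (Taubes 1994, §1, (1), (3), Lemma 1) — Čech form

Topic `Literature/Geometry/GaugeTheory`; continues `AdaptedFramesCanonicalSpinor` /
`AdaptedFramesCanonicalConnection` (for `𝔞 : AdaptedFrames g o J ι`: the canonical spinor `u₀`,
Taubes's connection `A₀ = 𝔞.canonicalConnection` with `∇̃^{A₀}_v u₀ = b_i(v) u₁`, the torsion
`b_i(v) = dρ(ω̃^{(i)}(v))_{u₁u₀}`, and `∂_{A₀} u₀ = 0 ↔ b₀ = i b₁ ∧ b₂ = i b₃`).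

C. H. Taubes, *The Seiberg–Witten invariants and symplectic forms*, Math. Res. Lett. 1 (1994), §1
(p. 810): "If the manifold `X` were honestly Kähler, with `ω` the Kähler form, then `u₀` would be
covariantly constant for `∇_{A₀}` as well.  Instead, one has (1) `∇_{A₀} u₀ = b` … (This `b` is
essentially the torsion of the almost complex structure that is defined by the metric and `ω`.)
The spinor `u₀` solves the Dirac equation when `b · u₁ = 0` …", (p. 811) "Lemma 1. The form `ω` is
closed if and only if `u₀` solves the Dirac equation.", "(3) `v₁ - i v₂ = 0` and `v₃ - i v₄ = 0`.
That is, `v` should be a section of `T*⁰'¹`."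

## What is PROVED (0 named facts)

For `𝔞 : AdaptedFrames g o J ι`, a chart `i`, a point `x ∈ U_i` with adapted frame
`(e₀, e₁ = Je₀, e₂, e₃ = Je₂)` and the Levi-Civita connection `∇` of `g`:

* `spinRepDeriv_inl_zero_inl_one`: the fibre identity `dρ(Ω)_{u₁u₀} = ½[(Ω₂₀ - Ω₃₁) + i(Ω₃₀ + Ω₂₁)]`,
  whence **`b_i(v) = ½[(g(∇_v e₀, e₂) - g(∇_v e₁, e₃)) + i(g(∇_v e₀, e₃) + g(∇_v e₁, e₂))]`**
  (`canonicalTorsion_eq`);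
* **`b` is the covariant derivative of `J`**: with `w(v) := ∇_v e₁ - J ∇_v e₀ = ∇_v(Je₀) - J∇_v e₀`
  (`= (∇_v J) e₀`, `frameTorsionVec`), **`2 b_i(v) = g(J w(v), e₂) + i g(w(v), e₂)`**
  (`two_mul_canonicalTorsion_eq`) — so `b = 0` where `∇J = 0` ("honestly Kähler",
  `canonicalTorsion_eq_zero_of_frameTorsionVec_eq_zero`);
* **the Dirac equation for `u₀` is the quasi-Kähler identity**: if `w(Jv) = -J w(v)` for all `v`
  at `x` — i.e. `(∇_{JX} J)(J e₀) = -(∇_X J) e₀`, the quasi-Kähler condition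
  `(∇_{JX} J) JY + (∇_X J) Y = 0` at `Y = e₀`, which almost Kähler manifolds (`dω = 0`) satisfy
  (A. Gray; this is the differential-geometric content of Taubes's Lemma 1) — then `b(Jv) = -i b(v)`
  (`canonicalTorsion_map_of_quasiKaehler`: `b` is of type `(0,1)`, Taubes's (3)) and
  **`∂_{A₀} u₀ (x) = 0`** (`dirac_canonicalConnection_canonicalSpinor_eq_zero_of_quasiKaehler`).

So Taubes's Lemma 1 (direction `dω = 0 ⇒ ∂_{A₀} u₀ = 0`) is reduced to the classical identity
`(∇_{JX} J) J = -(∇_X J)` for almost Kähler manifolds, which is NOT proved here.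

## References

* C. H. Taubes, *The Seiberg–Witten invariants and symplectic forms*, Math. Res. Lett. 1 (1994)
  809–822, §1 (pp. 810–811, (1), (3), Lemma 1). [Taubes1994]
* J. W. Morgan, *The Seiberg–Witten Equations and Applications to the Topology of Smooth
  Four-Manifolds*, Princeton Math. Notes 44 (1996), §3.2 (3.2), Lemma 3.2.4, §3.4. [MorganSWBook1996]
-/

noncomputable section

open scoped Manifold ContDiff Topology ComplexConjugate Matrix
open Set Function Complex
open Literature.Geometry.Lorentzian (PseudoRiemannianMetric)
open Literature.Topology.FourManifolds (SmoothOrientation)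

namespace Literature.Geometry.GaugeTheory

/-- Local notation: the model space `ℝ⁴`. -/
local notation "𝔼⁴" => EuclideanSpace ℝ (Fin 4)

/-! ### The fibre identity for `dρ(Ω)_{u₁u₀}` -/

/-- **`dρ(Ω)_{u₁u₀} = ½[(Ω₂₀ - Ω₃₁) + i(Ω₃₀ + Ω₂₁)]`** for a real `4 × 4` matrix `Ω`
(`dρ(Ω) = ½ Σ_{k<l} Ω_{lk} γ_kγ_l`; the `S⁺`-block of `γ_kγ_l` is `-m(e_k) m(e_l)ᴴ`).
[cite: MorganSWBook1996, Lemma 3.2.4] -/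
theorem spinRepDeriv_inl_zero_inl_one (Ω : Matrix (Fin 4) (Fin 4) ℝ) :
    spinRepDeriv Ω (Sum.inl 0) (Sum.inl 1) =
      2⁻¹ * (((Ω 2 0 - Ω 3 1 : ℝ) : ℂ) + I * ((Ω 3 0 + Ω 2 1 : ℝ) : ℂ)) := by
  simp only [spinRepDeriv, Matrix.smul_apply, smul_eq_mul, Fin.sum_univ_four, cliffordBasis, cliffordGamma,
    quatMatrix_quatBasis_zero, quatMatrix_quatBasis_one, quatMatrix_quatBasis_two, quatMatrix_quatBasis_three]
  simp [Matrix.mul_apply, Fintype.sum_sum_type, Fin.sum_univ_two, Matrix.fromBlocks_apply₁₁, Matrix.fromBlocks_apply₁₂,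
    Matrix.fromBlocks_apply₂₁, Matrix.conjTranspose_apply, Fin.lt_def, Matrix.add_apply]
  ring

section Bundle

variable {X : Type*} [TopologicalSpace X] [ChartedSpace 𝔼⁴ X] [IsManifold (𝓡 4) ∞ X]
  {g : PseudoRiemannianMetric (𝓡 4) ∞ 𝔼⁴ (TangentSpace (𝓡 4) : X → Type _)}
  {o : SmoothOrientation (𝓡 4) X} {J : Π x : X, TangentSpace (𝓡 4) x →ₗ[ℝ] TangentSpace (𝓡 4) x}
  {ι : Type*}

namespace AdaptedFrames

variable (𝔞 : AdaptedFrames g o J ι)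

/-! ### `J` is `g`-skew in an adapted frame -/

/-- **`g(JY, e₂) = -g(Y, e₃)`** at a point of an adapted orthonormal frame (`Je₂ = e₃`, `J` is
`g`-orthogonal): expand `Y = Σ_k g(Y, e_k) e_k`. [cite: MorganSWBook1996, §3.4] -/
theorem val_map_frame_two (i : ι) {x : X} (hx : x ∈ 𝔞.baseSet i) (Y : TangentSpace (𝓡 4) x) :
    g.val x (J x Y) (𝔞.frame i 2 x) = -g.val x Y (𝔞.frame i 3 x) := by
  have he := 𝔞.isOrthonormalFrame_frame i hx
  obtain ⟨h0, h1, h2, h3⟩ := 𝔞.isAdaptedFrame_frame i x hx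
  have h0' : J x (𝔞.frame i 0 x) = 𝔞.frame i 1 x := h0
  have h1' : J x (𝔞.frame i 1 x) = -𝔞.frame i 0 x := h1
  have h2' : J x (𝔞.frame i 2 x) = 𝔞.frame i 3 x := h2
  have h3' : J x (𝔞.frame i 3 x) = -𝔞.frame i 2 x := h3
  conv_lhs => rw [← sum_val_smul_frame_eq g he Y]
  simp only [Fin.sum_univ_four, map_add, map_smul, h0', h1', h2', h3', smul_neg, map_neg, add_apply,
    smul_apply, neg_apply, smul_eq_mul]
  rw [he.2 1 2 (by decide), he.2 0 2 (by decide), he.2 3 2 (by decide), he.1 2]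
  ring

/-- **`g(JY, e₃) = g(Y, e₂)`** at a point of an adapted orthonormal frame. [cite: MorganSWBook1996, §3.4] -/
theorem val_map_frame_three (i : ι) {x : X} (hx : x ∈ 𝔞.baseSet i) (Y : TangentSpace (𝓡 4) x) :
    g.val x (J x Y) (𝔞.frame i 3 x) = g.val x Y (𝔞.frame i 2 x) := by
  have he := 𝔞.isOrthonormalFrame_frame i hx
  obtain ⟨h0, h1, h2, h3⟩ := 𝔞.isAdaptedFrame_frame i x hx
  have h0' : J x (𝔞.frame i 0 x) = 𝔞.frame i 1 x := h0
  have h1' : J x (𝔞.frame i 1 x) = -𝔞.frame i 0 x := h1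
  have h2' : J x (𝔞.frame i 2 x) = 𝔞.frame i 3 x := h2
  have h3' : J x (𝔞.frame i 3 x) = -𝔞.frame i 2 x := h3
  conv_lhs => rw [← sum_val_smul_frame_eq g he Y]
  simp only [Fin.sum_univ_four, map_add, map_smul, h0', h1', h2', h3', smul_neg, map_neg, add_apply,
    smul_apply, neg_apply, smul_eq_mul]
  rw [he.2 1 3 (by decide), he.2 0 3 (by decide), he.1 3, he.2 2 3 (by decide)]
  ring

/-- `g(J(JY), e₂) = -g(Y, e₂)` at a point of an adapted orthonormal frame (`J² = -1` seen through
`e₂`). [cite: MorganSWBook1996, §3.4] -/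
theorem val_map_map_frame_two (i : ι) {x : X} (hx : x ∈ 𝔞.baseSet i) (Y : TangentSpace (𝓡 4) x) :
    g.val x (J x (J x Y)) (𝔞.frame i 2 x) = -g.val x Y (𝔞.frame i 2 x) := by
  rw [𝔞.val_map_frame_two i hx, 𝔞.val_map_frame_three i hx]

/-! ### Taubes's torsion `b` and the covariant derivative of `J` -/

section Torsion

variable [g.HasLeviCivita]

/-- **`b_i(v) = ½[(g(∇_v e₀, e₂) - g(∇_v e₁, e₃)) + i(g(∇_v e₀, e₃) + g(∇_v e₁, e₂))]`** with
`∇ = ∇^{LC}` and `e = e^{(i)}` (`Ω_{lk}(v) = g(∇_v e_k, e_l)`). [cite: Taubes1994, §1 (1)] -/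
theorem canonicalTorsion_eq (i : ι) (x : X) (v : TangentSpace (𝓡 4) x) :
    𝔞.canonicalTorsion i x v = 2⁻¹ *
      (((g.val x (g.leviCivita (𝔞.frame i 0) x v) (𝔞.frame i 2 x) -
            g.val x (g.leviCivita (𝔞.frame i 1) x v) (𝔞.frame i 3 x) : ℝ) : ℂ) +
        I * ((g.val x (g.leviCivita (𝔞.frame i 0) x v) (𝔞.frame i 3 x) +
            g.val x (g.leviCivita (𝔞.frame i 1) x v) (𝔞.frame i 2 x) : ℝ) : ℂ)) := by
  rw [canonicalTorsion, SpincStructure.spinConnectionEnd, spinRepDeriv_inl_zero_inl_one]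
  rfl

variable {𝔞} in
/-- **The vector `w(v) = ∇_v e₁ - J ∇_v e₀ = ∇_v(Je₀) - J ∇_v e₀ = (∇_v J) e₀`**: the covariant
derivative of `J` along `v`, tested on `e₀` ("essentially the torsion of the almost complex
structure"). [cite: Taubes1994, §1 (1)] -/
def frameTorsionVec (𝔞 : AdaptedFrames g o J ι) (i : ι) (x : X) (v : TangentSpace (𝓡 4) x) : TangentSpace (𝓡 4) x :=
  g.leviCivita (𝔞.frame i 1) x v - J x (g.leviCivita (𝔞.frame i 0) x v)

/-- **`2 b_i(v) = g(J w(v), e₂) + i g(w(v), e₂)`** with `w(v) = (∇_v J) e₀`: Taubes's torsion is the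
covariant derivative of `J`. [cite: Taubes1994, §1 (1)] -/
theorem two_mul_canonicalTorsion_eq (i : ι) {x : X} (hx : x ∈ 𝔞.baseSet i) (v : TangentSpace (𝓡 4) x) :
    2 * 𝔞.canonicalTorsion i x v =
      ((g.val x (J x (𝔞.frameTorsionVec i x v)) (𝔞.frame i 2 x) : ℝ) : ℂ) +
        I * ((g.val x (𝔞.frameTorsionVec i x v) (𝔞.frame i 2 x) : ℝ) : ℂ) := by
  rw [canonicalTorsion_eq, frameTorsionVec, map_sub, map_sub, map_sub, sub_apply, sub_apply,
    𝔞.val_map_map_frame_two i hx,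
    𝔞.val_map_frame_two i hx (g.leviCivita (𝔞.frame i 1) x v),
    𝔞.val_map_frame_two i hx (g.leviCivita (𝔞.frame i 0) x v)]
  push_cast
  ring

/-- **"If the manifold were honestly Kähler … `u₀` would be covariantly constant"**: where
`(∇_v J) e₀ = 0`, Taubes's torsion vanishes, `b_i(v) = 0` (so `∇̃^{A₀}_v u₀ = 0`). [cite: Taubes1994, §1 (p. 810)] -/
theorem canonicalTorsion_eq_zero_of_frameTorsionVec_eq_zero (i : ι) {x : X} (hx : x ∈ 𝔞.baseSet i)
    {v : TangentSpace (𝓡 4) x} (hw : 𝔞.frameTorsionVec i x v = 0) : 𝔞.canonicalTorsion i x v = 0 := by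
  have h2 := 𝔞.two_mul_canonicalTorsion_eq i hx v
  rw [hw, map_zero, map_zero, zero_apply] at h2
  simpa using h2

/-- **`b` is of type `(0,1)` under the quasi-Kähler identity**: if `w(Jv) = -J w(v)`
(`(∇_{Jv} J) e₀ = -J (∇_v J) e₀`, the quasi-Kähler condition of almost Kähler manifolds at `e₀`) then
`b_i(Jv) = -i b_i(v)` (Taubes's (3): "`v` should be a section of `T*⁰'¹`"). [cite: Taubes1994, §1 (3)] -/
theorem canonicalTorsion_map_of_quasiKaehler (i : ι) {x : X} (hx : x ∈ 𝔞.baseSet i) {v : TangentSpace (𝓡 4) x}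
    (hq : 𝔞.frameTorsionVec i x (J x v) = -J x (𝔞.frameTorsionVec i x v)) :
    𝔞.canonicalTorsion i x (J x v) = -I * 𝔞.canonicalTorsion i x v := by
  have hJ := 𝔞.two_mul_canonicalTorsion_eq i hx (J x v)
  have hv := 𝔞.two_mul_canonicalTorsion_eq i hx v
  rw [hq, map_neg, map_neg, map_neg, neg_apply, neg_apply, 𝔞.val_map_map_frame_two i hx] at hJ
  have h2 : 2 * 𝔞.canonicalTorsion i x (J x v) = -I * (2 * 𝔞.canonicalTorsion i x v) := by
    rw [hJ, hv]
    push_cast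
    ring_nf
    rw [I_sq]
    ring
  linear_combination (2 : ℂ)⁻¹ * h2

/-- **Taubes's Lemma 1, reduced to the quasi-Kähler identity**: if at `x ∈ U_i` the covariant
derivative of `J` satisfies `(∇_{Jv} J) e₀ = -J (∇_v J) e₀` for all `v` (as on an almost Kähler
manifold, `dω = 0`), then **`∂_{A₀} u₀ (x) = 0`**: `b` is of type `(0,1)`, so `b(e₀) = i b(e₁)`
and `b(e₂) = i b(e₃)` for `e₁ = Je₀`, `e₃ = Je₂`. [cite: Taubes1994, §1 Lemma 1 (p. 811)] -/
theorem dirac_canonicalConnection_canonicalSpinor_eq_zero_of_quasiKaehler (i : ι) {x : X}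
    (hx : x ∈ 𝔞.baseSet i)
    (hq : ∀ v : TangentSpace (𝓡 4) x, 𝔞.frameTorsionVec i x (J x v) = -J x (𝔞.frameTorsionVec i x v)) :
    SpincStructure.dirac 𝔞.canonicalConnection 𝔞.canonicalSpinor i x = 0 := by
  obtain ⟨h0, -, h2, -⟩ := 𝔞.isAdaptedFrame_frame i x hx
  have h0' : J x (𝔞.frame i 0 x) = 𝔞.frame i 1 x := h0
  have h2' : J x (𝔞.frame i 2 x) = 𝔞.frame i 3 x := h2
  rw [𝔞.dirac_canonicalConnection_canonicalSpinor_eq_zero_iff i x, ← h0', ← h2',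
    𝔞.canonicalTorsion_map_of_quasiKaehler i hx (hq _), 𝔞.canonicalTorsion_map_of_quasiKaehler i hx (hq _)]
  constructor <;> rw [← mul_assoc, mul_neg, I_mul_I, neg_neg, one_mul]

end Torsion

end AdaptedFrames

end Bundle

end Literature.Geometry.GaugeTheory

end
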